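import Mathlib
import Summits.ValiantsHypothesis.ValiantsHypothesis.Theorems.NewtonTauWeak.Negative.Zonogon
import Summits.ValiantsHypothesis.ValiantsHypothesis.Theorems.NewtonUnitEquationsDissociatedFixedKExposedWord
import Literature.RingTheory.TwoVariableSeries.Basic

/-!
# Rung toward `stub_binomialNewtonTau` (crux `NewtonTauWeak`, stmt-ValiantsHypothesis-5904):
# the separated-variables rank bound

If the coefficient "matrix" `M(x, y) = [X^x Y^y] f` of a bivariate polynomial `f` has rank `≤ K`
in the sense that every row function `y ↦ M(x, y)` lies in the `ℂ`-span of `K` fixed functions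
`ℕ → ℂ`, then the Newton polygon of `f` (convex hull in `ℝ²` of the support) has at most `4 K`
vertices (`SeparatedRank.vert_le_of_rows_mem_span`).  In particular
`vert (Σ_{l<K} P_l(X) · Q_l(Y)) ≤ 4 K` for separated variables (`vert_sum_mul_le_of_separated`):
KPTT-type digit frames with common axis-parallel exponents cannot host a counterexample to the
binomial Newton-polygon τ-statement.

Proof.
* Geometry (`SeparatedRank.exists_exposed_of_mem_extremePoints`): an extreme point of the hull of a
  finite set `S ⊆ ℕ²` is `emb e₀`, `e₀ ∈ S`, strictly exposed by a linear functional `w₀ x + w₁ y`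
  (the tree's `exists_strict_sep_of_mem_extremePoints_convexHull`, Hahn–Banach).  Strict exposure
  forbids two points of `S` at the height of `e₀` on both sides of `e₀` ("unflanked": they would
  force `w₀ > 0` and `w₀ < 0`), and `w₁ ≥ 0` (resp. `w₁ < 0`) forces `e₀` to be the top (resp.
  bottom) point of `S` on its vertical line.
* Counting (`SeparatedRank.card_le_two_mul_card_image`): on each horizontal line at most two points
  of a finite set `P` are unflanked in `P`, so such points number `≤ 2 · #{heights of P}`.
* Rank (`SeparatedRank.card_image_le_of_top` / `_of_bot`): rows of `M` whose top (resp. bottom)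
  non-zero entries sit in pairwise distinct columns are linearly independent (echelon/pivot
  argument, `linearIndependent_of_pivot`), hence at most `K` of them fit into a span of `K`
  functions (`linearIndependent_le_span_aux'`); so the top points of `S` have `≤ K` distinct
  heights, and so do the bottom points.  Total: `≤ 2K + 2K`.
[folklore]
-/

set_option linter.dupNamespace false

namespace Summit.ValiantsHypothesis.ValiantsHypothesis.Theorems.NewtonUnitEquationsNewtonTauWeak

open MvPolynomial
open Summit.ValiantsHypothesis.ValiantsHypothesis.Theorems.NewtonTauWeak.Negative (vert)
open Summit.ValiantsHypothesis.Theorems.DissociatedFixedK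
  (exists_strict_sep_of_mem_extremePoints_convexHull)

namespace SeparatedRank

/-! ## Linear algebra: rows in echelon position are linearly independent -/

/-- Pivot criterion for linear independence of a family of functions `v i : ℕ → ℂ`: each `v i` is
non-zero at its pivot `piv i`, and every non-empty finite subfamily contains a member `a` at whose
pivot all OTHER members of the subfamily vanish.  (Induction: in a vanishing combination the
coefficient of `a` vanishes, then recurse on the rest.) [folklore] -/
theorem linearIndependent_of_pivot {ι : Type*} (v : ι → ℕ → ℂ) (piv : ι → ℕ)
    (hpiv : ∀ i, v i (piv i) ≠ 0)
    (hext : ∀ s : Finset ι, s.Nonempty → ∃ a ∈ s, ∀ i ∈ s, i ≠ a → v i (piv a) = 0) :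
    LinearIndependent ℂ v := by
  classical
  rw [linearIndependent_iff']
  intro s
  induction s using Finset.strongInduction with
  | H s ih =>
    intro c hsum i hi
    obtain ⟨a, ha, hvan⟩ := hext s ⟨i, hi⟩
    have hca : c a = 0 := by
      have h := congrFun hsum (piv a)
      rw [Finset.sum_apply, Finset.sum_eq_single a] at h
      · simpa [hpiv a] using h
      · intro j hj hja
        simp [hvan j hj hja]
      · exact fun h => (h ha).elim
    by_cases hia : i = a
    · exact hia ▸ hca
    · refine ih (s.erase a) (Finset.erase_ssubset ha) c ?_ i (Finset.mem_erase.mpr ⟨hia, hi⟩)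
      rw [Finset.sum_erase s (by rw [hca, zero_smul])]
      exact hsum

/-- A linearly independent family of functions lying in the span of `K` functions has at most `K`
members (strong rank condition for the field `ℂ`). [folklore] -/
theorem fintype_card_le_of_mem_span {ι : Type*} [Fintype ι] {K : ℕ} (v : ι → ℕ → ℂ)
    (hv : LinearIndependent ℂ v) (g : Fin K → ℕ → ℂ)
    (hmem : ∀ i, v i ∈ Submodule.span ℂ (Set.range g)) : Fintype.card ι ≤ K := by
  classical
  have hsub : Set.range v ≤ (Submodule.span ℂ (Set.range g) : Set (ℕ → ℂ)) := by
    rintro _ ⟨i, rfl⟩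
    exact hmem i
  calc Fintype.card ι ≤ Fintype.card (Set.range g) := linearIndependent_le_span_aux' v hv _ hsub
    _ ≤ Fintype.card (Fin K) := Fintype.card_range_le g
    _ = K := Fintype.card_fin K

/-! ## Planar combinatorics: unflanked points

A point `e` is UNFLANKED in `P ⊆ ℕ²` when there are no `e₁, e₂ ∈ P` on the horizontal line through
`e` with `e₁ 0 < e 0 < e₂ 0`; it is the TOP (BOTTOM) point of `S` on its vertical line when every
`e' ∈ S` with `e' 0 = e 0` has `e' 1 ≤ e 1` (`e 1 ≤ e' 1`).  Both notions are spelled out inline. -/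

/-- **Counting.** On each horizontal line at most two points of `P` (the leftmost and the rightmost)
are unflanked in `P`; hence a set `F ⊆ P` of points unflanked in `P` has at most twice as many
elements as `P` has heights. [folklore] -/
theorem card_le_two_mul_card_image (P F : Finset (Fin 2 →₀ ℕ)) (hFP : F ⊆ P)
    (hF : ∀ e ∈ F, ∀ e₁ ∈ P, ∀ e₂ ∈ P, e₁ 1 = e 1 → e₂ 1 = e 1 → e₁ 0 < e 0 → e 0 < e₂ 0 → False) :
    F.card ≤ 2 * (P.image fun e => e 1).card := by
  classical
  -- record the height and whether the point is the leftmost point of `P` at that height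
  let φ : (Fin 2 →₀ ℕ) → ℕ × Bool := fun e => (e 1, decide (∀ e' ∈ P, e' 1 = e 1 → e 0 ≤ e' 0))
  have hmaps : Set.MapsTo φ (F : Set (Fin 2 →₀ ℕ))
      ((P.image fun e => e 1) ×ˢ (Finset.univ : Finset Bool) : Finset (ℕ × Bool)) := by
    intro e he
    rw [Finset.coe_product, Finset.coe_univ, Set.mem_prod]
    exact ⟨Finset.mem_coe.mpr (Finset.mem_image_of_mem _ (hFP he)), Set.mem_univ _⟩
  have hinj : Set.InjOn φ (F : Set (Fin 2 →₀ ℕ)) := by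
    intro e he e' he' h
    rw [Finset.mem_coe] at he he'
    obtain ⟨h1, hb⟩ := Prod.ext_iff.mp h
    simp only [φ, decide_eq_decide] at h1 hb
    refine Literature.RingTheory.TwoVariableSeries.finsupp_fin2_ext ?_ h1
    by_cases hA : ∀ e'' ∈ P, e'' 1 = e 1 → e 0 ≤ e'' 0
    · exact le_antisymm (hA e' (hFP he') h1.symm) (hb.mp hA e (hFP he) h1)
    · have hA' : ¬ ∀ e'' ∈ P, e'' 1 = e' 1 → e' 0 ≤ e'' 0 := fun h' => hA (hb.mpr h')
      push Not at hA hA'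
      obtain ⟨e₁, he₁, he₁1, hlt₁⟩ := hA
      obtain ⟨e₂, he₂, he₂1, hlt₂⟩ := hA'
      rcases lt_trichotomy (e 0) (e' 0) with hlt | heq | hgt
      · exact (hF e he e₁ he₁ e' (hFP he') he₁1 h1.symm hlt₁ hlt).elim
      · exact heq
      · exact (hF e' he' e₂ he₂ e (hFP he) he₂1 h1 hlt₂ hgt).elim
  calc F.card ≤ ((P.image fun e => e 1) ×ˢ (Finset.univ : Finset Bool)).card :=
        Finset.card_le_card_of_injOn φ hmaps hinj
    _ = 2 * (P.image fun e => e 1).card := by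
        rw [Finset.card_product, Finset.card_univ, Fintype.card_bool, mul_comm]

/-! ## Geometry: extreme points are unflanked top/bottom points -/

/-- **Exposure.** Every extreme point of the convex hull of the real embedding of a finite
`S ⊆ ℕ²` is the image of some `e₀ ∈ S` which is unflanked in `S` and is the top or the bottom
point of `S` on its vertical line: `e₀` is strictly exposed by a linear functional `w₀ x + w₁ y`
(`exists_strict_sep_of_mem_extremePoints_convexHull`); two flanking points would force `w₀ > 0` and
`w₀ < 0`; `w₁ ≥ 0` gives a top point, `w₁ < 0` a bottom point. [folklore] -/
theorem exists_exposed_of_mem_extremePoints (S : Finset (Fin 2 →₀ ℕ)) (p : Fin 2 → ℝ)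
    (hp : p ∈ Set.extremePoints ℝ (convexHull ℝ
      ((fun e : Fin 2 →₀ ℕ => fun i : Fin 2 => ((e i : ℕ) : ℝ)) '' (S : Set (Fin 2 →₀ ℕ))))) :
    ∃ e₀ ∈ S, (fun i : Fin 2 => ((e₀ i : ℕ) : ℝ)) = p ∧
      (∀ e₁ ∈ S, ∀ e₂ ∈ S, e₁ 1 = e₀ 1 → e₂ 1 = e₀ 1 → e₁ 0 < e₀ 0 → e₀ 0 < e₂ 0 → False) ∧
      ((∀ e' ∈ S, e' 0 = e₀ 0 → e' 1 ≤ e₀ 1) ∨ (∀ e' ∈ S, e' 0 = e₀ 0 → e₀ 1 ≤ e' 1)) := by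
  obtain ⟨e₀, he₀, rfl⟩ := extremePoints_convexHull_subset hp
  obtain ⟨l, hl⟩ := exists_strict_sep_of_mem_extremePoints_convexHull (S.finite_toSet.image _) hp
  -- `l` in coordinates: `l y = w₀ * y 0 + w₁ * y 1`
  have hl2 : ∀ y : Fin 2 → ℝ, l y = l (Pi.single 0 1) * y 0 + l (Pi.single 1 1) * y 1 := by
    intro y
    have hy : y = y 0 • (Pi.single 0 1 : Fin 2 → ℝ) + y 1 • (Pi.single 1 1 : Fin 2 → ℝ) := by
      ext i; fin_cases i <;> simp
    conv_lhs => rw [hy]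
    simp only [map_add, map_smul, smul_eq_mul]
    ring
  set w₀ := l (Pi.single 0 1)
  set w₁ := l (Pi.single 1 1)
  have hstrict : ∀ s ∈ S, s ≠ e₀ → w₀ * ((s 0 : ℕ) : ℝ) + w₁ * ((s 1 : ℕ) : ℝ) <
      w₀ * ((e₀ 0 : ℕ) : ℝ) + w₁ * ((e₀ 1 : ℕ) : ℝ) := by
    intro s hs hne
    have h := hl _ ⟨s, Finset.mem_coe.mpr hs, rfl⟩ fun h =>
      hne (Finsupp.ext fun i => Nat.cast_injective (R := ℝ) (congrFun h i))
    rwa [hl2, hl2] at h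
  refine ⟨e₀, Finset.mem_coe.mp he₀, rfl, ?_, ?_⟩
  · intro e₁ he₁ e₂ he₂ h11 h21 hlt1 hlt2
    have hne1 : e₁ ≠ e₀ := fun h => by rw [h] at hlt1; exact lt_irrefl _ hlt1
    have hne2 : e₂ ≠ e₀ := fun h => by rw [h] at hlt2; exact lt_irrefl _ hlt2
    have i1 := hstrict e₁ he₁ hne1
    have i2 := hstrict e₂ he₂ hne2
    rw [h11] at i1; rw [h21] at i2
    have c1 : ((e₁ 0 : ℕ) : ℝ) < e₀ 0 := by exact_mod_cast hlt1
    have c2 : ((e₀ 0 : ℕ) : ℝ) < e₂ 0 := by exact_mod_cast hlt2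
    have hw0 : 0 < w₀ := by
      by_contra h
      have h' : w₀ * ((e₀ 0 : ℕ) : ℝ) ≤ w₀ * ((e₁ 0 : ℕ) : ℝ) :=
        mul_le_mul_of_nonpos_left c1.le (not_lt.mp h)
      linarith
    have : w₀ * ((e₀ 0 : ℕ) : ℝ) < w₀ * ((e₂ 0 : ℕ) : ℝ) := mul_lt_mul_of_pos_left c2 hw0
    linarith
  · rcases le_or_gt 0 w₁ with hnn | hneg
    · left
      intro e' he' h0
      by_contra hlt
      have hlt' : e₀ 1 < e' 1 := not_le.mp hlt
      have hne : e' ≠ e₀ := fun h => by rw [h] at hlt'; exact lt_irrefl _ hlt'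
      have i1 := hstrict e' he' hne
      rw [h0] at i1
      have c : ((e₀ 1 : ℕ) : ℝ) ≤ e' 1 := by exact_mod_cast hlt'.le
      have : w₁ * ((e₀ 1 : ℕ) : ℝ) ≤ w₁ * ((e' 1 : ℕ) : ℝ) := mul_le_mul_of_nonneg_left c hnn
      linarith
    · right
      intro e' he' h0
      by_contra hlt
      have hlt' : e' 1 < e₀ 1 := not_le.mp hlt
      have hne : e' ≠ e₀ := fun h => by rw [h] at hlt'; exact lt_irrefl _ hlt'
      have i1 := hstrict e' he' hne
      rw [h0] at i1
      have c : ((e' 1 : ℕ) : ℝ) < e₀ 1 := by exact_mod_cast hlt'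
      have : w₁ * ((e₀ 1 : ℕ) : ℝ) < w₁ * ((e' 1 : ℕ) : ℝ) := mul_lt_mul_of_neg_left c hneg
      linarith

/-! ## Rank: top points (and bottom points) of the support have at most `K` heights -/

/-- **Rank step (abstract pivots).** Let the rows `y ↦ [X^x Y^y] f` of the coefficient matrix of `f`
lie in the span of `K` functions, and let `P ⊆ supp f` be such that every non-empty finite set `s`
of heights contains a height `a` at which the rows through all points of `P` with height in
`s ∖ {a}` vanish.  Then `P` has at most `K` distinct heights: one row per height gives a family in
echelon position (`linearIndependent_of_pivot`), hence linearly independent, inside a span of `K`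
vectors. [folklore] -/
theorem card_image_le_of_rows_mem_span {K : ℕ} (f : MvPolynomial (Fin 2) ℂ) (g : Fin K → ℕ → ℂ)
    (hrows : ∀ x : ℕ, (fun y => coeff (Finsupp.single 0 x + Finsupp.single 1 y) f) ∈
      Submodule.span ℂ (Set.range g))
    (P : Finset (Fin 2 →₀ ℕ)) (hPS : P ⊆ f.support)
    (hext : ∀ s : Finset ℕ, s.Nonempty → ∃ a ∈ s, ∀ e ∈ P, e 1 ∈ s → e 1 ≠ a →
      coeff (Finsupp.single 0 (e 0) + Finsupp.single 1 a) f = 0) :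
    (P.image fun e => e 1).card ≤ K := by
  classical
  have hpick : ∀ t ∈ P.image (fun e => e 1), ∃ e ∈ P, e 1 = t := fun t ht => by
    simpa only [Finset.mem_image] using ht
  choose! pick hpickP hpick1 using hpick
  -- one row of the coefficient matrix per height: the row through the chosen point of that height
  let v : (P.image fun e => e 1) → ℕ → ℂ := fun t y =>
    coeff (Finsupp.single 0 (pick t 0) + Finsupp.single 1 y) f
  have hv : LinearIndependent ℂ v := by
    apply linearIndependent_of_pivot v (fun t => (t : ℕ))
    · intro t
      have hkey : Finsupp.single 0 (pick t 0) + Finsupp.single 1 (t : ℕ) = pick t :=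
        Literature.RingTheory.TwoVariableSeries.finsupp_fin2_ext (by simp) (by simp [hpick1 t t.2])
      show coeff (Finsupp.single 0 (pick t 0) + Finsupp.single 1 (t : ℕ)) f ≠ 0
      rw [hkey, ← mem_support_iff]
      exact hPS (hpickP t t.2)
    · intro s hs
      obtain ⟨a, ha, hvan⟩ := hext (s.image Subtype.val) (hs.image _)
      obtain ⟨a', ha', rfl⟩ := Finset.mem_image.mp ha
      refine ⟨a', ha', fun t ht hta => ?_⟩
      have h1 : pick t 1 ∈ s.image Subtype.val := by
        rw [hpick1 t t.2]
        exact Finset.mem_image_of_mem _ ht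
      have h2 : pick t 1 ≠ (a' : ℕ) := by
        rw [hpick1 t t.2]
        exact fun h => hta (Subtype.ext h)
      exact hvan (pick t) (hpickP t t.2) h1 h2
  have hcard := fintype_card_le_of_mem_span v hv g fun t => hrows (pick t 0)
  rwa [Fintype.card_coe] at hcard

/-- The TOP points of the support of `f` have at most `K` distinct heights (pivot = the largest
height: a row vanishes above its top point). -/
theorem card_image_le_of_top {K : ℕ} (f : MvPolynomial (Fin 2) ℂ) (g : Fin K → ℕ → ℂ)
    (hrows : ∀ x : ℕ, (fun y => coeff (Finsupp.single 0 x + Finsupp.single 1 y) f) ∈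
      Submodule.span ℂ (Set.range g))
    (P : Finset (Fin 2 →₀ ℕ)) (hPS : P ⊆ f.support)
    (hP : ∀ e ∈ P, ∀ e' ∈ f.support, e' 0 = e 0 → e' 1 ≤ e 1) :
    (P.image fun e => e 1).card ≤ K := by
  refine card_image_le_of_rows_mem_span f g hrows P hPS fun s hs => ?_
  refine ⟨s.max' hs, s.max'_mem hs, fun e he hes hne => ?_⟩
  have hlt : e 1 < s.max' hs := lt_of_le_of_ne (s.le_max' _ hes) hne
  by_contra hcoef
  have htop := hP e he _ (mem_support_iff.mpr hcoef) (by simp)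
  simp only [Finsupp.coe_add, Pi.add_apply, Finsupp.single_eq_same] at htop
  rw [Finsupp.single_eq_of_ne (by decide), zero_add] at htop
  exact absurd htop (not_le.mpr hlt)

/-- The BOTTOM points of the support of `f` have at most `K` distinct heights (pivot = the smallest
height: a row vanishes below its bottom point). -/
theorem card_image_le_of_bot {K : ℕ} (f : MvPolynomial (Fin 2) ℂ) (g : Fin K → ℕ → ℂ)
    (hrows : ∀ x : ℕ, (fun y => coeff (Finsupp.single 0 x + Finsupp.single 1 y) f) ∈
      Submodule.span ℂ (Set.range g))
    (P : Finset (Fin 2 →₀ ℕ)) (hPS : P ⊆ f.support)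
    (hP : ∀ e ∈ P, ∀ e' ∈ f.support, e' 0 = e 0 → e 1 ≤ e' 1) :
    (P.image fun e => e 1).card ≤ K := by
  refine card_image_le_of_rows_mem_span f g hrows P hPS fun s hs => ?_
  refine ⟨s.min' hs, s.min'_mem hs, fun e he hes hne => ?_⟩
  have hlt : s.min' hs < e 1 := lt_of_le_of_ne (s.min'_le _ hes) (Ne.symm hne)
  by_contra hcoef
  have hbot := hP e he _ (mem_support_iff.mpr hcoef) (by simp)
  simp only [Finsupp.coe_add, Pi.add_apply, Finsupp.single_eq_same] at hbot
  rw [Finsupp.single_eq_of_ne (by decide), zero_add] at hbot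
  exact absurd hbot (not_le.mpr hlt)

/-! ## The rank bound -/

/-- **Separated-variables rank bound (row-span form).** If every row `y ↦ [X^x Y^y] f` of the
coefficient matrix of `f ∈ ℂ[X, Y]` lies in the `ℂ`-span of `K` fixed functions `ℕ → ℂ`, then the
Newton polygon of `f` has at most `4 K` vertices: every vertex is an unflanked top or bottom point
of the support (`exists_exposed_of_mem_extremePoints`), at most two unflanked points per height
(`card_le_two_mul_card_image`), at most `K` heights of top points and `K` of bottom points
(`card_image_le_of_top`, `card_image_le_of_bot`). [folklore] -/
theorem vert_le_of_rows_mem_span {K : ℕ} (f : MvPolynomial (Fin 2) ℂ) (g : Fin K → ℕ → ℂ)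
    (hrows : ∀ x : ℕ, (fun y => coeff (Finsupp.single 0 x + Finsupp.single 1 y) f) ∈
      Submodule.span ℂ (Set.range g)) :
    vert f ≤ 4 * K := by
  classical
  unfold vert
  set S := f.support
  -- top / bottom points of the support, and the unflanked ones among them
  set PT := S.filter fun e => ∀ e' ∈ S, e' 0 = e 0 → e' 1 ≤ e 1
  set PB := S.filter fun e => ∀ e' ∈ S, e' 0 = e 0 → e 1 ≤ e' 1
  set FT := PT.filter fun e =>
    ∀ e₁ ∈ PT, ∀ e₂ ∈ PT, e₁ 1 = e 1 → e₂ 1 = e 1 → e₁ 0 < e 0 → e 0 < e₂ 0 → False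
  set FB := PB.filter fun e =>
    ∀ e₁ ∈ PB, ∀ e₂ ∈ PB, e₁ 1 = e 1 → e₂ 1 = e 1 → e₁ 0 < e 0 → e 0 < e₂ 0 → False
  have hsub : Set.extremePoints ℝ (convexHull ℝ
      ((fun e : Fin 2 →₀ ℕ => fun i : Fin 2 => ((e i : ℕ) : ℝ)) '' (S : Set (Fin 2 →₀ ℕ)))) ⊆
      (fun e : Fin 2 →₀ ℕ => fun i : Fin 2 => ((e i : ℕ) : ℝ)) ''
        ((FT ∪ FB : Finset _) : Set _) := by
    intro p hp
    obtain ⟨e₀, he₀, hemb, hnf, htb⟩ := exists_exposed_of_mem_extremePoints S p hp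
    refine ⟨e₀, ?_, hemb⟩
    rw [Finset.mem_coe, Finset.mem_union]
    rcases htb with ht | hb
    · left
      have hmem : e₀ ∈ PT := Finset.mem_filter.mpr ⟨he₀, ht⟩
      exact Finset.mem_filter.mpr ⟨hmem, fun e₁ he₁ e₂ he₂ =>
        hnf e₁ (Finset.mem_filter.mp he₁).1 e₂ (Finset.mem_filter.mp he₂).1⟩
    · right
      have hmem : e₀ ∈ PB := Finset.mem_filter.mpr ⟨he₀, hb⟩
      exact Finset.mem_filter.mpr ⟨hmem, fun e₁ he₁ e₂ he₂ =>
        hnf e₁ (Finset.mem_filter.mp he₁).1 e₂ (Finset.mem_filter.mp he₂).1⟩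
  have hT : (PT.image fun e => e 1).card ≤ K :=
    card_image_le_of_top f g hrows PT (Finset.filter_subset _ _)
      fun e he => (Finset.mem_filter.mp he).2
  have hB : (PB.image fun e => e 1).card ≤ K :=
    card_image_le_of_bot f g hrows PB (Finset.filter_subset _ _)
      fun e he => (Finset.mem_filter.mp he).2
  have hFT : FT.card ≤ 2 * (PT.image fun e => e 1).card :=
    card_le_two_mul_card_image PT FT (Finset.filter_subset _ _)
      fun e he => (Finset.mem_filter.mp he).2
  have hFB : FB.card ≤ 2 * (PB.image fun e => e 1).card :=
    card_le_two_mul_card_image PB FB (Finset.filter_subset _ _)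
      fun e he => (Finset.mem_filter.mp he).2
  calc (Set.extremePoints ℝ (convexHull ℝ
        ((fun e : Fin 2 →₀ ℕ => fun i : Fin 2 => ((e i : ℕ) : ℝ)) '' (S : Set (Fin 2 →₀ ℕ))))).ncard
      ≤ ((fun e : Fin 2 →₀ ℕ => fun i : Fin 2 => ((e i : ℕ) : ℝ)) ''
          ((FT ∪ FB : Finset _) : Set (Fin 2 →₀ ℕ))).ncard :=
        Set.ncard_le_ncard hsub ((FT ∪ FB).finite_toSet.image _)
    _ ≤ ((FT ∪ FB : Finset _) : Set (Fin 2 →₀ ℕ)).ncard := Set.ncard_image_le (FT ∪ FB).finite_toSet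
    _ = (FT ∪ FB).card := Set.ncard_coe_finset _
    _ ≤ FT.card + FB.card := Finset.card_union_le _ _
    _ ≤ 2 * K + 2 * K := by omega
    _ = 4 * K := by ring

/-! ## Separated products -/

/-- Coefficient of `X^x Y^y` in `P(X) · Q(Y)` for separated variables: `[X^x] P · [Y^y] Q`
(the only splitting of `(x, y)` into an `X`-exponent plus a `Y`-exponent). -/
theorem coeff_mul_of_separated (P Q : MvPolynomial (Fin 2) ℂ) (hP : ∀ e ∈ P.support, e 1 = 0)
    (hQ : ∀ e ∈ Q.support, e 0 = 0) (x y : ℕ) :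
    coeff (Finsupp.single 0 x + Finsupp.single 1 y) (P * Q) =
      coeff (Finsupp.single 0 x) P * coeff (Finsupp.single 1 y) Q := by
  classical
  rw [coeff_mul]
  have hmem : (Finsupp.single (0 : Fin 2) x, Finsupp.single (1 : Fin 2) y) ∈
      Finset.HasAntidiagonal.antidiagonal
        (Finsupp.single (0 : Fin 2) x + Finsupp.single (1 : Fin 2) y) :=
    Finset.HasAntidiagonal.mem_antidiagonal.mpr rfl
  rw [← Finset.add_sum_erase _ _ hmem]
  convert add_zero _
  refine Finset.sum_eq_zero ?_
  rintro ⟨a, b⟩ hab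
  obtain ⟨hne, hab⟩ := Finset.mem_erase.mp hab
  rw [Finset.HasAntidiagonal.mem_antidiagonal] at hab
  by_contra h
  obtain ⟨ha, hb⟩ := mul_ne_zero_iff.mp h
  have ha1 := hP a (mem_support_iff.mpr ha)
  have hb0 := hQ b (mem_support_iff.mpr hb)
  have h0 := DFunLike.congr_fun hab 0
  have h1 := DFunLike.congr_fun hab 1
  simp only [Finsupp.coe_add, Pi.add_apply, Finsupp.single_eq_same, hb0, ha1, add_zero,
    zero_add] at h0 h1
  rw [Finsupp.single_eq_of_ne (by decide), add_zero] at h0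
  rw [Finsupp.single_eq_of_ne (by decide), zero_add] at h1
  exact hne (Prod.ext (Literature.RingTheory.TwoVariableSeries.finsupp_fin2_ext (by simp [h0]) (by simp [ha1]))
    (Literature.RingTheory.TwoVariableSeries.finsupp_fin2_ext (by simp [hb0]) (by simp [h1])))

end SeparatedRank

/-- **Separated-variables rank bound.** For `f = Σ_{l<K} P_l · Q_l ∈ ℂ[X, Y]` with every `P_l`
involving only `X = X 0` and every `Q_l` only `Y = X 1`, the Newton polygon of `f` has at most `4 K`
vertices: the rows `y ↦ [X^x Y^y] f = Σ_l [X^x] P_l · [Y^y] Q_l` of the coefficient matrix lie in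
the span of the `K` functions `y ↦ [Y^y] Q_l`, and `SeparatedRank.vert_le_of_rows_mem_span` applies.
(A rung toward `stub_binomialNewtonTau`: KPTT Example-3 frames with common axis-parallel digit
exponents cannot host a counterexample.) [folklore] -/
theorem vert_sum_mul_le_of_separated (K : ℕ) (P Q : Fin K → MvPolynomial (Fin 2) ℂ)
    (hP : ∀ l, ∀ e ∈ (P l).support, e 1 = 0) (hQ : ∀ l, ∀ e ∈ (Q l).support, e 0 = 0) :
    vert (∑ l, P l * Q l) ≤ 4 * K := by
  apply SeparatedRank.vert_le_of_rows_mem_span _ (fun l y => coeff (Finsupp.single 1 y) (Q l))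
  intro x
  have key : (fun y => coeff (Finsupp.single 0 x + Finsupp.single 1 y) (∑ l, P l * Q l)) =
      ∑ l, coeff (Finsupp.single 0 x) (P l) • (fun y => coeff (Finsupp.single 1 y) (Q l)) := by
    funext y
    rw [Finset.sum_apply, coeff_sum]
    refine Finset.sum_congr rfl fun l _ => ?_
    rw [Pi.smul_apply, smul_eq_mul]
    exact SeparatedRank.coeff_mul_of_separated (P l) (Q l) (hP l) (hQ l) x y
  rw [key]
  exact Submodule.sum_mem _ fun l _ =>
    Submodule.smul_mem _ _ (Submodule.subset_span (Set.mem_range_self l))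

end Summit.ValiantsHypothesis.ValiantsHypothesis.Theorems.NewtonUnitEquationsNewtonTauWeak
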